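import Summits.BirchSwinnertonDyer.BirchSwinnertonDyer.Theorems.AdditiveBranchIMCTwistRootNumberTwistedAux
import HarnessLib

/-!
# `w(E^{(d_K)}) = −w(E)` on the TWISTED road — the E3′ root-number engine, FIRST CUT (case A, `E` not additive at `2`) (LEAD g15)

Theorems-side engine (theorems only; no definition, no named fact, no `sorry`), the fifth of the line after p744621
`TwistRootNumberOdd`, p754623 `TwistRootNumberOddThree`, p758548 `TwistRootNumberAnyTwo` (w(E^{(qℓ)}) = w(E) at a NON-SPLIT
multiplicative Wan prime `q`) and p777009 `TwistRootNumberDyadic`. Brick E3′ of crux 19357 / 19358 (pen memo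
`pub/bsd-addord/planner/g2_3f_enlarge/e19/README.md` v6 §2, §4 (g); sketch `Cruxes/GordTwoRankOne/TwistedWanSketch.lean` v4, statement
`EngineTwisted`) replaces the multiplicative Wan prime by a POTENTIALLY-MULTIPLICATIVE ADDITIVE prime `ℓ₀` of quadratic-twist type
(`W₁ := E^{(ℓ₀*)}` multiplicative at `ℓ₀`) RAMIFIED in the road field `K`, `d_K = ℓ₀*·m`, with the CLASS of `m` at `ℓ₀` chosen so that
`E/K_λ` is non-split multiplicative. This file proves the sign: in CASE A (`W₁` NON-split at `ℓ₀`, class `(m/ℓ₀) = +1`) and for `E`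
not additive at `2`,

  `w(E^{(ℓ₀*·m)}) = −w(E)`

whenever `m ≡ 1 (mod 4)`-type bookkeeping holds in the form the field supplies it: `D := ℓ₀*·m ≡ 1 (mod 8)` (so `2` splits in
`K = ℚ(√D)`), `D < 0`, `m` square-free and prime to `ℓ₀`, every prime of `m` a GOOD prime of `E` (the `K`-ramified primes other
than `ℓ₀`), `(D/v) = 1` at every odd bad prime `v ≠ ℓ₀` of `E` (they split in `K`), and `m` an `ℓ₀`-adic square (case A).

MODULAR proof, as p758548: `w = −ε(f)`, `ε(f) = ∏_{v ∣ N} λ_v(f)`. The newform `f'` of `E^{(D)}` has level `N_E·m²/ℓ₀` — the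
level DROPS at `ℓ₀`: `E^{(D)} = W₁^{(m)}` with `m` an `ℓ₀`-adic square is `ℚ_{ℓ₀}`-isomorphic to `W₁`, MULTIPLICATIVE NON-SPLIT, so
`λ_{ℓ₀}(f') = W_{ℓ₀}(W₁) = +1`, while `λ_{ℓ₀}(f) = (−1/ℓ₀)` (additive of twist type, Atkin–Li via
`atkinLehnerEigenvalueAt_eq_χ₄_of_twist_of_le`); at a prime `r ∣ m` (good for `E`, additive of twist type for `E^{(D)}`)
`λ_r(f') = (−1/r)`; at every other bad prime `D` is a `v`-adic square and `λ_v(f') = λ_v(f)` (multiplicative: local root number;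
odd additive of twist type: both `(−1/v)`); no additive `2`. Hence `ε(f')/ε(f) = (−1/|m|)(−1/ℓ₀) = (−1/|D|) = −1` since
`|D| = −D ≡ 3 (mod 4)`.

* `rootNumber_quadraticTwist_eq_neg_of_potMult_caseA` (the reduction lemmas at the primes of `m` are in `…TwistRootNumberTwistedAux`).

Purpose: the sign input of the E3′ field supply `FieldOneTwistedR0` / `FieldOneTwisted` (stub `stub_fieldOneTwistedR0` of 19357
`three_field_road` v37; 19358 v26) on the first cut. BSD is proved for no curve by any of this.
References: [AtkinLi1978] §1, §3; [Rohrlich1993Compositio] Prop. 2 (ii)–(iii), Prop. 3; [KellockDokchitser2023] Rem. 2.2, Thm. 2.3;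
[Knapp1993] Thm. 9.27; [SilvermanAEC2009] VII.5 Prop. 5.1, X.5 Cor. 5.4.
-/

set_option linter.dupNamespace false
set_option autoImplicit false

noncomputable section

open scoped MatrixGroups Classical

open CongruenceSubgroup Literature.NumberTheory.EllipticCurves Literature.NumberTheory.EllipticCurves.ModularForms
  IsDedekindDomain IsDedekindDomain.HeightOneSpectrum NumberField Rat.HeightOneSpectrum WeierstrassCurve
  Summit.BirchSwinnertonDyer.BirchSwinnertonDyer.Theorems

namespace Summit.BirchSwinnertonDyer.BirchSwinnertonDyer.Theorems.TwistRootNumberTwisted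

variable (W : WeierstrassCurve ℚ) [W.IsElliptic] [W.IsGloballyMinimal]

/-- `natGenerator` of the place of `ℤ` under a prime `p` is `p` (the tree's `Rat.natGenerator_primesEquiv_symm`). [folklore] -/
private theorem natGenerator_symm' (p : Nat.Primes) : natGenerator ((primesEquiv (R := ℤ)).symm p) = p :=
  Literature.NumberTheory.EllipticCurves.Rat.natGenerator_primesEquiv_symm p

/-- **The E3′ root-number engine, first cut (case A, no additive `2`)**: for `E / ℚ` (global minimal `W`, every odd additive prime of
quadratic-twist type, NOT additive at `2`), an odd prime `ℓ₀` at which `E` is additive and `W₁ = E^{(ℓ₀*)}` is NON-SPLIT multiplicative,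
and `D = ℓ₀*·m` with `D ≡ 1 (mod 8)`, `D < 0`, `m` square-free, `ℓ₀ ∤ m`, every prime of `m` good for `E`, `(D/v) = 1` at the odd bad
primes `v ≠ ℓ₀` of `E`, and `m` a square in `ℚ_{ℓ₀}` (case A: `(m/ℓ₀) = +1`): `w(E^{(D)}) = −w(E)`. This is `w(E/K) = −1` for the
twisted road field `K = ℚ(√D)` (ℓ₀ ramified in the non-split class, every other bad prime and `2` split).
[cite: AtkinLi1978, §1 and §3] [cite: Rohrlich1993Compositio, Prop. 2 (ii)–(iii) and Prop. 3] [cite: KellockDokchitser2023, Rem. 2.2 and Thm. 2.3]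
[cite: Knapp1993, Thm. 9.27] -/
theorem rootNumber_quadraticTwist_eq_neg_of_potMult_caseA (hmod : exists_isNewformOf)
    (htt : ∀ p : Nat.Primes, (p : ℕ) ≠ 2 → W.HasAdditiveReductionAt ((primesEquiv (R := ℤ)).symm p) →
      ¬ (W.quadraticTwist (((-1 : ℤ) ^ ((p : ℕ) / 2) * p : ℤ) : ℚ)).HasAdditiveReductionAt
        ((primesEquiv (R := ℤ)).symm p))
    (h2 : ¬ W.HasAdditiveReductionAt ((primesEquiv (R := ℤ)).symm ⟨2, Nat.prime_two⟩))
    {ℓ₀ : ℕ} [hℓ₀ : Fact ℓ₀.Prime] (hℓ₀2 : ℓ₀ ≠ 2)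
    (hadd₀ : W.HasAdditiveReductionAt ((primesEquiv (R := ℤ)).symm ⟨ℓ₀, hℓ₀.out⟩))
    (hmult₀ : (W.quadraticTwist (((-1 : ℤ) ^ (ℓ₀ / 2) * ℓ₀ : ℤ) : ℚ)).HasMultiplicativeReductionAtPrime ℓ₀)
    (hns₀ : ¬ (W.quadraticTwist (((-1 : ℤ) ^ (ℓ₀ / 2) * ℓ₀ : ℤ) : ℚ)).HasSplitMultiplicativeReductionAtPrime ℓ₀)
    {D m : ℤ} (hDm : D = (-1 : ℤ) ^ (ℓ₀ / 2) * ℓ₀ * m) (h8 : D % 8 = 1) (hDneg : D < 0) (hmsq : Squarefree m)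
    (hℓ₀m : ¬ (ℓ₀ : ℤ) ∣ m) (hgood : ∀ r : Nat.Primes, ((r : ℕ) : ℤ) ∣ m → W.HasGoodReductionAt ((primesEquiv (R := ℤ)).symm r))
    (hjac : ∀ p : ℕ, p.Prime → p ∣ W.conductorNorm ℤ → p ≠ 2 → p ≠ ℓ₀ → jacobiSym D p = 1)
    (hsqA : IsSquare ((m : ℤ) : ℚ_[ℓ₀])) :
    (W.quadraticTwist (D : ℚ)).rootNumber = -W.rootNumber := by
  -- §0 set-up
  set s : ℤ := (-1 : ℤ) ^ (ℓ₀ / 2) * ℓ₀ with hs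
  have hs0 : s ≠ 0 := mul_ne_zero (pow_ne_zero _ (by norm_num)) (by exact_mod_cast hℓ₀.out.ne_zero)
  have hm0 : m ≠ 0 := by rintro rfl; exact hℓ₀m (dvd_zero _)
  have hD0 : D ≠ 0 := by rw [hDm]; exact mul_ne_zero hs0 hm0
  have hDQ : (D : ℚ) ≠ 0 := by exact_mod_cast hD0
  have hD4 : D % 4 = 1 := by omega
  set W' := W.quadraticTwist (D : ℚ) with hW'
  haveI : W'.IsElliptic := W.isElliptic_quadraticTwist hDQ
  set W₁ := W.quadraticTwist ((s : ℤ) : ℚ) with hW₁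
  haveI : W₁.IsElliptic := W.isElliptic_quadraticTwist (show ((s : ℤ) : ℚ) ≠ 0 by exact_mod_cast hs0)
  set Pℓ : Nat.Primes := ⟨ℓ₀, hℓ₀.out⟩ with hPℓ
  set P2 : Nat.Primes := ⟨2, Nat.prime_two⟩ with hP2
  set vℓ : HeightOneSpectrum ℤ := (primesEquiv (R := ℤ)).symm Pℓ with hvℓ
  set N := W.conductorNorm ℤ with hN
  set N' := W'.conductorNorm ℤ with hN'
  have hN0 : N ≠ 0 := (W.conductorNorm_pos_holds).ne'
  have hN'0 : N' ≠ 0 := (W'.conductorNorm_pos_holds).ne'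
  have hM0 : m.natAbs ≠ 0 := Int.natAbs_ne_zero.mpr hm0
  haveI : NeZero (W.conductorNorm ℤ) := ⟨hN0⟩
  haveI : NeZero (W'.conductorNorm ℤ) := ⟨hN'0⟩
  have hMsq : Squarefree m.natAbs := Int.squarefree_natAbs.mpr hmsq
  have hℓ₀s : (ℓ₀ : ℤ) ∣ s := by rw [hs]; exact dvd_mul_left _ _
  -- `W' = W₁^{(m)}`
  have hW'W₁ : W₁.quadraticTwist (m : ℚ) = W' := by
    rw [hW', hW₁, quadraticTwist_quadraticTwist, hDm]; push_cast; ring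
  -- parity facts: `D`, `m`, `ℓ₀` odd; primes of `m` are odd, `≠ ℓ₀`, and do not divide `N`
  have hDodd : ¬ (2 : ℤ) ∣ D := by omega
  have hmodd : ¬ (2 : ℤ) ∣ m := fun h ↦ hDodd (by rw [hDm]; exact h.mul_left _)
  have hprime_m : ∀ r : Nat.Primes, ((r : ℕ) : ℤ) ∣ m → (r : ℕ) ≠ 2 ∧ (r : ℕ) ≠ ℓ₀ ∧ ¬ (r : ℕ) ∣ N := by
    intro r hr
    refine ⟨fun h ↦ hmodd (by have h' := hr; rw [h] at h'; exact_mod_cast h'), fun h ↦ hℓ₀m (by rw [← h]; exact hr),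
      fun hrN ↦ ?_⟩
    haveI := Fact.mk r.2
    exact ((W.dvd_conductorNorm_iff_not_hasGoodReductionAtPrime r).mp hrN)
      ((W.hasGoodReductionAtPrime_iff_hasGoodReductionAt_holds r).mpr (hgood r hr))
  -- the divisors of `D`: a prime dividing `D` is `ℓ₀` or divides `m`
  have hdvd_D : ∀ r : Nat.Primes, ((r : ℕ) : ℤ) ∣ D → (r : ℕ) = ℓ₀ ∨ ((r : ℕ) : ℤ) ∣ m := by
    intro r hr
    rw [hDm] at hr
    have hrZ : Prime ((r : ℕ) : ℤ) := Nat.prime_iff_prime_int.mp r.2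
    rcases hrZ.dvd_or_dvd hr with h | h
    · left
      have h' : ((r : ℕ) : ℤ) ∣ (ℓ₀ : ℤ) := by
        rw [hs] at h; exact ((isUnit_neg_one (α := ℤ)).pow _).dvd_mul_left.mp h
      exact (Nat.prime_dvd_prime_iff_eq r.2 hℓ₀.out).mp (Int.natCast_dvd_natCast.mp h')
    · exact Or.inr h
  have hℓ₀D : ((ℓ₀ : ℕ) : ℤ) ∣ D := by rw [hDm]; exact hℓ₀s.mul_right _
  have hbadN_not_dvd_D : ∀ r : Nat.Primes, (r : ℕ) ∣ N → (r : ℕ) ≠ ℓ₀ → ¬ ((r : ℕ) : ℤ) ∣ D := by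
    intro r hrN hrℓ hrD
    rcases hdvd_D r hrD with h | h
    · exact hrℓ h
    · exact (hprime_m r h).2.2 hrN
  -- `D` is a square at `2` and at the odd bad primes `≠ ℓ₀`
  have hsq : ∀ r : Nat.Primes, (r : ℕ) ∣ N → (r : ℕ) ≠ ℓ₀ → haveI := Fact.mk r.2; IsSquare ((D : ℤ) : ℚ_[r]) := by
    intro r hrN hrℓ
    haveI := Fact.mk r.2
    by_cases hr2 : (r : ℕ) = 2
    · exact isSquare_padic_of_emod_eight_eq_one hr2 h8
    · exact isSquare_padic_of_jacobiSym_eq_one hr2 (hjac r r.2 hrN hr2 hrℓ)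
  -- §1 `W'` at the primes NOT dividing `D`: same reduction type, same conductor exponent
  have hred : ∀ r : Nat.Primes, ¬ ((r : ℕ) : ℤ) ∣ D →
      (W'.HasGoodReductionAt ((primesEquiv (R := ℤ)).symm r) ↔ W.HasGoodReductionAt ((primesEquiv (R := ℤ)).symm r)) ∧
      (W'.HasMultiplicativeReductionAt ((primesEquiv (R := ℤ)).symm r) ↔
        W.HasMultiplicativeReductionAt ((primesEquiv (R := ℤ)).symm r)) ∧
      (W'.HasAdditiveReductionAt ((primesEquiv (R := ℤ)).symm r) ↔ W.HasAdditiveReductionAt ((primesEquiv (R := ℤ)).symm r)) := by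
    intro r hrD
    by_cases hr2 : (r : ℕ) = 2
    · haveI := Fact.mk r.2
      have hsq' : IsSquare ((D : ℤ) : ℚ_[r]) := isSquare_padic_of_emod_eight_eq_one hr2 h8
      exact ⟨W.hasGoodReductionAt_quadraticTwist_iff_of_isSquare r hD0 hsq',
        W.hasMultiplicativeReductionAt_quadraticTwist_iff_of_isSquare r hD0 hsq',
        W.hasAdditiveReductionAt_quadraticTwist_iff_of_isSquare r hD0 hsq'⟩
    · exact W.hasReductionAt_quadraticTwist_iff_of_not_dvd _ (by rw [natGenerator_symm']; exact hr2)
        (by rw [natGenerator_symm']; exact hrD)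
  have hfac_eq : ∀ r : Nat.Primes, ¬ ((r : ℕ) : ℤ) ∣ D → N'.factorization r = N.factorization r := by
    intro r hrD
    have h := W.factorization_conductorNorm_quadraticTwist_eq_of_not_dvd hD4 ((primesEquiv (R := ℤ)).symm r)
      (by rw [natGenerator_symm']; exact hrD)
    rw [natGenerator_symm'] at h
    exact h
  -- §2 `W'` at `ℓ₀`: `W' = W₁^{(m)}` with `m` an `ℓ₀`-adic square — MULTIPLICATIVE NON-SPLIT, local root number `+1`
  have hmultW₁ : W₁.HasMultiplicativeReductionAt vℓ := (W₁.hasMultiplicativeReductionAtPrime_iff_hasMultiplicativeReductionAt_holds Pℓ).mp hmult₀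
  have hmult' : W'.HasMultiplicativeReductionAt vℓ := by
    rw [← hW'W₁]; exact (W₁.hasMultiplicativeReductionAt_quadraticTwist_iff_of_isSquare Pℓ hm0 hsqA).mpr hmultW₁
  have hfℓ' : W'.conductorExponent vℓ = 1 := (conductorExponent_eq_one_iff_holds vℓ W').mpr hmult'
  have hsemi₀ : ¬ W₁.HasAdditiveReductionAt vℓ := hmultW₁.not_hasAdditiveReductionAt
  have hfℓ : W.conductorExponent vℓ = 2 :=
    TwistTypeConductor.conductorExponent_eq_two_of_twistType_odd W Pℓ hℓ₀2 hadd₀ (fun _ ↦ hsemi₀)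
  have hlocW' : W'.localRootNumberAt vℓ = 1 := by
    rw [← hW'W₁, hvℓ, W₁.localRootNumberAt_quadraticTwist_of_isSquare Pℓ hm0 hsqA, localRootNumberAt_primesEquiv_symm_eq,
      localRootNumber_of_hasMultiplicativeReduction _ _ hmult₀ hns₀]
  -- §3 `W'` at the primes of `m`: ADDITIVE of twist type, `f = 2`
  have hadd_m : ∀ r : Nat.Primes, ((r : ℕ) : ℤ) ∣ m → W'.HasAdditiveReductionAt ((primesEquiv (R := ℤ)).symm r) := by
    intro r hr
    obtain ⟨hr2, hrℓ, -⟩ := hprime_m r hr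
    have h1 : ((r : ℕ) : ℤ) ∣ D := by rw [hDm]; exact hr.mul_left _
    have h2 : ¬ ((r : ℕ) : ℤ) ^ 2 ∣ D := by
      rintro ⟨w, hw⟩
      have hrZ : Prime ((r : ℕ) : ℤ) := Nat.prime_iff_prime_int.mp r.2
      have hr0 : ((r : ℕ) : ℤ) ≠ 0 := by exact_mod_cast r.2.ne_zero
      obtain ⟨u, hu⟩ := hr
      -- `D = s·m = s·r·u = r²·w`, so `s·u = r·w`
      have hsu : s * u = r * w := by
        apply mul_left_cancel₀ hr0
        have : D = (r : ℤ) * (s * u) := by rw [hDm, hu]; ring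
        rw [← this, hw]; ring
      have hrs : ¬ ((r : ℕ) : ℤ) ∣ s := by
        intro h'
        have h'' : ((r : ℕ) : ℤ) ∣ (ℓ₀ : ℤ) := by
          rw [hs] at h'; exact ((isUnit_neg_one (α := ℤ)).pow _).dvd_mul_left.mp h'
        exact hrℓ ((Nat.prime_dvd_prime_iff_eq r.2 hℓ₀.out).mp (Int.natCast_dvd_natCast.mp h''))
      have hru : ((r : ℕ) : ℤ) ∣ u := by
        rcases hrZ.dvd_or_dvd (show ((r : ℕ) : ℤ) ∣ s * u from ⟨w, hsu⟩) with h' | h'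
        · exact absurd h' hrs
        · exact h'
      obtain ⟨t, ht⟩ := hru
      have hr2m : ((r : ℤ) * r) ∣ m := ⟨t, by rw [hu, ht]; ring⟩
      have hunit := hmsq (r : ℤ) hr2m
      rcases Int.isUnit_iff.mp hunit with h1 | h1
      · exact r.2.ne_one (by exact_mod_cast h1)
      · have : (0 : ℤ) ≤ (r : ℕ) := by positivity
        omega
    exact hasAdditiveReductionAt_quadraticTwist_of_good W hD0 r hr2 h1 h2 (hgood r hr)
  have hsemi_m : ∀ r : Nat.Primes, ((r : ℕ) : ℤ) ∣ m →
      ¬ (W'.quadraticTwist (((-1 : ℤ) ^ ((r : ℕ) / 2) * r : ℤ) : ℚ)).HasAdditiveReductionAt ((primesEquiv (R := ℤ)).symm r) := by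
    intro r hr
    obtain ⟨hr2, hrℓ, -⟩ := hprime_m r hr
    obtain ⟨u, hu⟩ := hr
    have hDu : D = r * (s * u) := by rw [hDm, hu]; ring
    have hru : ¬ ((r : ℕ) : ℤ) ∣ s * u := by
      intro h
      have hrZ : Prime ((r : ℕ) : ℤ) := Nat.prime_iff_prime_int.mp r.2
      rcases hrZ.dvd_or_dvd h with h' | h'
      · have h'' : ((r : ℕ) : ℤ) ∣ (ℓ₀ : ℤ) := by
          rw [hs] at h'; exact ((isUnit_neg_one (α := ℤ)).pow _).dvd_mul_left.mp h'
        exact hrℓ ((Nat.prime_dvd_prime_iff_eq r.2 hℓ₀.out).mp (Int.natCast_dvd_natCast.mp h''))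
      · -- `r² ∣ m`
        have hr2m : ((r : ℤ) * r) ∣ m := by rw [hu]; exact mul_dvd_mul_left _ h'
        have hunit := hmsq (r : ℤ) hr2m
        rcases Int.isUnit_iff.mp hunit with h1 | h1
        · exact r.2.ne_one (by exact_mod_cast h1)
        · have : (0 : ℤ) ≤ (r : ℕ) := by positivity
          omega
    exact not_hasAdditiveReductionAt_quadraticTwist_pStar_of_good W r hr2 hDu hru (hgood r ⟨u, hu⟩)
  have hf_m : ∀ r : Nat.Primes, ((r : ℕ) : ℤ) ∣ m → W'.conductorExponent ((primesEquiv (R := ℤ)).symm r) = 2 := fun r hr ↦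
    TwistTypeConductor.conductorExponent_eq_two_of_twistType_odd W' r (hprime_m r hr).1 (hadd_m r hr) (fun _ ↦ hsemi_m r hr)
  have hf_m0 : ∀ r : Nat.Primes, ((r : ℕ) : ℤ) ∣ m → W.conductorExponent ((primesEquiv (R := ℤ)).symm r) = 0 := fun r hr ↦
    (conductorExponent_eq_zero_iff_holds _ W).mpr (hgood r hr)
  -- §4 `W'` is of odd twist type everywhere (so the `hle` bound of the tree applies to it)
  have httW' : ∀ p : Nat.Primes, (p : ℕ) ≠ 2 → W'.HasAdditiveReductionAt ((primesEquiv (R := ℤ)).symm p) →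
      ¬ (W'.quadraticTwist (((-1 : ℤ) ^ ((p : ℕ) / 2) * p : ℤ) : ℚ)).HasAdditiveReductionAt ((primesEquiv (R := ℤ)).symm p) := by
    intro r hr2 ha'
    by_cases hrD : ((r : ℕ) : ℤ) ∣ D
    · rcases hdvd_D r hrD with h | h
      · -- `r = ℓ₀`: `W'` is multiplicative there, not additive
        exfalso
        have : r = Pℓ := Subtype.ext h
        rw [this] at ha'
        exact hmult'.not_hasAdditiveReductionAt ha'
      · exact hsemi_m r h
    · have ha : W.HasAdditiveReductionAt ((primesEquiv (R := ℤ)).symm r) := ((hred r hrD).2.2).mp ha'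
      exact TwistRootNumberAnyTwo.twistType_quadraticTwist_of_not_dvd W htt D r hr2 (by rw [natGenerator_symm']; exact hrD) ha
  have hle := TwistRootNumberAnyTwo.conductorExponent_pStar_le W htt
  have hle' := TwistRootNumberAnyTwo.conductorExponent_pStar_le W' httW'
  -- §5 the prime factors of `N'`: those of `N` together with those of `m`
  have hdvd_iff : ∀ (n : ℕ) (hn : n ≠ 0) (p : Nat.Primes), (p : ℕ) ∣ n ↔ n.factorization p ≠ 0 := by
    intro n hn p
    rw [Ne, Nat.factorization_eq_zero_iff]
    push Not
    exact ⟨fun h ↦ ⟨p.2, h, hn⟩, fun h ↦ h.2.1⟩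
  have hℓN : ℓ₀ ∣ N := (hdvd_iff N hN0 Pℓ).mpr (by rw [factorization_conductorNorm_primesEquiv_symm W Pℓ, ← hvℓ, hfℓ]; norm_num)
  have hℓN' : ℓ₀ ∣ N' := (hdvd_iff N' hN'0 Pℓ).mpr (by rw [factorization_conductorNorm_primesEquiv_symm W' Pℓ, ← hvℓ, hfℓ']; norm_num)
  have hℓℓN' : ¬ ℓ₀ ^ 2 ∣ N' := by
    rw [hℓ₀.out.pow_dvd_iff_le_factorization hN'0, show N'.factorization ℓ₀ = N'.factorization Pℓ from rfl,
      factorization_conductorNorm_primesEquiv_symm W' Pℓ, ← hvℓ, hfℓ']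
    omega
  have hm_dvd_iff : ∀ r : Nat.Primes, (r : ℕ) ∣ m.natAbs ↔ ((r : ℕ) : ℤ) ∣ m := fun r ↦ Int.natCast_dvd.symm
  have hpf : N'.primeFactors = N.primeFactors ∪ m.natAbs.primeFactors := by
    ext r
    simp only [Finset.mem_union, Nat.mem_primeFactors]
    constructor
    · rintro ⟨hr, hrN', -⟩
      set R : Nat.Primes := ⟨r, hr⟩
      by_cases hrD : ((r : ℕ) : ℤ) ∣ D
      · rcases hdvd_D R hrD with h | h
        · exact Or.inl ⟨hr, by rw [show r = ℓ₀ from h]; exact hℓN, hN0⟩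
        · exact Or.inr ⟨hr, (hm_dvd_iff R).mpr h, hM0⟩
      · left
        refine ⟨hr, ?_, hN0⟩
        have h := (hdvd_iff N' hN'0 R).mp hrN'
        rw [show N'.factorization R = N'.factorization r from rfl, hfac_eq R hrD] at h
        exact (hdvd_iff N hN0 R).mpr h
    · rintro (⟨hr, hrN, -⟩ | ⟨hr, hrM, -⟩)
      · set R : Nat.Primes := ⟨r, hr⟩
        refine ⟨hr, ?_, hN'0⟩
        by_cases hrℓ : r = ℓ₀
        · rw [hrℓ]; exact hℓN'
        · have hrD : ¬ ((r : ℕ) : ℤ) ∣ D := hbadN_not_dvd_D R hrN hrℓ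
          have h := (hdvd_iff N hN0 R).mp hrN
          rw [← hfac_eq R hrD] at h
          exact (hdvd_iff N' hN'0 R).mpr h
      · set R : Nat.Primes := ⟨r, hr⟩
        refine ⟨hr, ?_, hN'0⟩
        exact (hdvd_iff N' hN'0 R).mpr (by
          rw [factorization_conductorNorm_primesEquiv_symm W' R, hf_m R ((hm_dvd_iff R).mp hrM)]; norm_num)
  have hdisj : Disjoint N.primeFactors m.natAbs.primeFactors := by
    rw [Finset.disjoint_left]
    intro r hrN hrM
    obtain ⟨hr, hrN', -⟩ := Nat.mem_primeFactors.mp hrN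
    obtain ⟨-, hrM', -⟩ := Nat.mem_primeFactors.mp hrM
    exact (hprime_m ⟨r, hr⟩ ((hm_dvd_iff ⟨r, hr⟩).mp hrM')).2.2 hrN'
  have hℓmem : ℓ₀ ∈ N.primeFactors := Nat.mem_primeFactors.mpr ⟨hℓ₀.out, hℓN, hN0⟩
  -- §6 newforms and Atkin–Lehner eigenvalues
  obtain ⟨f, hf⟩ := hmod W
  obtain ⟨f', hf'⟩ := hmod W'
  have hε := IsNewform0.frickeEigenvalue_eq_prod_atkinLehnerEigenvalueAt_holds hf.1
  have hε' := IsNewform0.frickeEigenvalue_eq_prod_atkinLehnerEigenvalueAt_holds hf'.1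
  -- at `ℓ₀`: `λ(f') = +1`, `λ(f) = χ₄ ℓ₀`
  have hlamℓ' : atkinLehnerEigenvalueAt f' ℓ₀ = 1 := by
    have h := W'.atkinLehnerEigenvalueAt_eq_localRootNumberAt_of_not_sq_dvd hf' Pℓ hℓN' hℓℓN'
    rw [h, ← hvℓ, hlocW']
    simp
  have hlamℓ : atkinLehnerEigenvalueAt f ℓ₀ = (ZMod.χ₄ ℓ₀ : ℂ) :=
    W.atkinLehnerEigenvalueAt_eq_χ₄_of_twist_of_le hmod hf Pℓ hℓ₀2 hadd₀ hsemi₀ hfℓ (hle Pℓ hℓ₀2)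
  -- at the primes of `m`: `λ(f') = χ₄ r`
  have hlam_m : ∀ r ∈ m.natAbs.primeFactors, atkinLehnerEigenvalueAt f' r = (ZMod.χ₄ r : ℂ) := by
    intro r hr
    obtain ⟨hrp, hrM, -⟩ := Nat.mem_primeFactors.mp hr
    set R : Nat.Primes := ⟨r, hrp⟩
    have hrm : ((R : ℕ) : ℤ) ∣ m := (hm_dvd_iff R).mp hrM
    exact W'.atkinLehnerEigenvalueAt_eq_χ₄_of_twist_of_le hmod hf' R (hprime_m R hrm).1 (hadd_m R hrm) (hsemi_m R hrm)
      (hf_m R hrm) (hle' R (hprime_m R hrm).1)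
  -- at the other primes of `N`: `λ(f') = λ(f)`
  have hlam_eq : ∀ r ∈ N.primeFactors.erase ℓ₀, atkinLehnerEigenvalueAt f' r = atkinLehnerEigenvalueAt f r := by
    intro r hr
    obtain ⟨hrℓ, hrN⟩ := Finset.mem_erase.mp hr
    obtain ⟨hrp, hrdvd, -⟩ := Nat.mem_primeFactors.mp hrN
    set R : Nat.Primes := ⟨r, hrp⟩
    haveI := Fact.mk hrp
    have hrD : ¬ ((r : ℕ) : ℤ) ∣ D := hbadN_not_dvd_D R hrdvd hrℓ
    have hbad : ¬ W.HasGoodReductionAt ((primesEquiv (R := ℤ)).symm R) := fun hg ↦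
      ((W.dvd_conductorNorm_iff_not_hasGoodReductionAtPrime r).mp hrdvd)
        ((W.hasGoodReductionAtPrime_iff_hasGoodReductionAt_holds R).mpr hg)
    rcases hasGoodReductionAt_or_hasMultiplicativeReductionAt_or_hasAdditiveReductionAt
      ((primesEquiv (R := ℤ)).symm R) W with h | hm | ha
    · exact absurd h hbad
    · -- multiplicative: both are the local root number, and `W' ≅ W` over `ℚ_r`
      have hf1 : W.conductorExponent ((primesEquiv (R := ℤ)).symm R) = 1 := (conductorExponent_eq_one_iff_holds _ W).mpr hm
      have hf1' : W'.conductorExponent ((primesEquiv (R := ℤ)).symm R) = 1 :=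
        (conductorExponent_eq_one_iff_holds _ W').mpr (((hred R hrD).2.1).mpr hm)
      have hrN' : r ∣ N' := (hdvd_iff N' hN'0 R).mpr (by rw [factorization_conductorNorm_primesEquiv_symm W' R, hf1']; norm_num)
      have hrrN' : ¬ r ^ 2 ∣ N' := by
        rw [hrp.pow_dvd_iff_le_factorization hN'0, show N'.factorization r = N'.factorization R from rfl,
          factorization_conductorNorm_primesEquiv_symm W' R, hf1']
        omega
      have hrrN : ¬ r ^ 2 ∣ N := by
        rw [hrp.pow_dvd_iff_le_factorization hN0, show N.factorization r = N.factorization R from rfl,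
          factorization_conductorNorm_primesEquiv_symm W R, hf1]
        omega
      rw [W'.atkinLehnerEigenvalueAt_eq_localRootNumberAt_of_not_sq_dvd hf' R hrN' hrrN',
        W.atkinLehnerEigenvalueAt_eq_localRootNumberAt_of_not_sq_dvd hf R hrdvd hrrN,
        W.localRootNumberAt_quadraticTwist_of_isSquare R hD0 (hsq R hrdvd hrℓ)]
    · -- additive: `r` is odd (no additive `2`), of twist type, both eigenvalues are `χ₄ r`
      have hr2 : r ≠ 2 := by
        intro h
        have : R = P2 := Subtype.ext h
        rw [this] at ha
        exact h2 ha
      have hsemi := htt R hr2 ha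
      have ha' : W'.HasAdditiveReductionAt ((primesEquiv (R := ℤ)).symm R) := ((hred R hrD).2.2).mpr ha
      have hsemi' := httW' R hr2 ha'
      rw [W'.atkinLehnerEigenvalueAt_eq_χ₄_of_twist_of_le hmod hf' R hr2 ha' hsemi'
          (TwistTypeConductor.conductorExponent_eq_two_of_twistType_odd W' R hr2 ha' (fun _ ↦ hsemi')) (hle' R hr2),
        W.atkinLehnerEigenvalueAt_eq_χ₄_of_twist_of_le hmod hf R hr2 ha hsemi
          (TwistTypeConductor.conductorExponent_eq_two_of_twistType_odd W R hr2 ha (fun _ ↦ hsemi)) (hle R hr2)]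
  -- §7 the products
  have hP : ∏ r ∈ N.primeFactors.erase ℓ₀, atkinLehnerEigenvalueAt f' r =
      ∏ r ∈ N.primeFactors.erase ℓ₀, atkinLehnerEigenvalueAt f r := Finset.prod_congr rfl hlam_eq
  have hPm' : ∏ r ∈ m.natAbs.primeFactors, ZMod.χ₄ (r : ZMod 4) = ZMod.χ₄ (m.natAbs : ZMod 4) := by
    conv_rhs => rw [← Nat.prod_primeFactors_of_squarefree hMsq, Nat.cast_prod, map_prod]
  have hPm : ∏ r ∈ m.natAbs.primeFactors, atkinLehnerEigenvalueAt f' r = (ZMod.χ₄ (m.natAbs : ZMod 4) : ℂ) := by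
    rw [Finset.prod_congr rfl hlam_m]
    exact_mod_cast congrArg (fun z : ℤ ↦ (z : ℂ)) hPm'
  -- the sign: `χ₄ |m| · χ₄ ℓ₀ = χ₄ |D| = −1`
  have hχ : (ZMod.χ₄ (m.natAbs : ZMod 4) : ℂ) = -(ZMod.χ₄ ℓ₀ : ℂ) := by
    have hMD : D.natAbs = ℓ₀ * m.natAbs := by
      rw [hDm, hs, Int.natAbs_mul, Int.natAbs_mul, Int.natAbs_pow, Int.natAbs_neg, Int.natAbs_one, one_pow, one_mul,
        Int.natAbs_natCast]
    have hDabs : ((D.natAbs : ℕ) : ℤ) = -D := by rw [Int.natCast_natAbs, abs_of_neg hDneg]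
    have hD3 : D.natAbs % 4 = 3 := by omega
    have hprod : ZMod.χ₄ (ℓ₀ : ZMod 4) * ZMod.χ₄ (m.natAbs : ZMod 4) = -1 := by
      rw [← map_mul, ← Nat.cast_mul, ← hMD]
      exact χ₄_natCast_eq_neg_one_of_mod_four hD3
    have hℓsq : ZMod.χ₄ (ℓ₀ : ZMod 4) * ZMod.χ₄ (ℓ₀ : ZMod 4) = 1 := by
      rcases Nat.odd_mod_four_iff.mp (Nat.odd_iff.mp (hℓ₀.out.odd_of_ne_two hℓ₀2)) with h | h
      · rw [ZMod.χ₄_nat_one_mod_four h]; norm_num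
      · rw [ZMod.χ₄_nat_three_mod_four h]; norm_num
    have key : ZMod.χ₄ (m.natAbs : ZMod 4) = -ZMod.χ₄ (ℓ₀ : ZMod 4) := by
      have h := congrArg (ZMod.χ₄ (ℓ₀ : ZMod 4) * ·) hprod
      simp only [← mul_assoc, hℓsq, one_mul, mul_neg, mul_one] at h
      exact h
    exact_mod_cast congrArg (fun z : ℤ ↦ (z : ℂ)) key
  have hεeq : frickeEigenvalue f' = -frickeEigenvalue f := by
    rw [hε', hε, hpf, Finset.prod_union hdisj, ← Finset.mul_prod_erase _ _ hℓmem,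
      ← Finset.mul_prod_erase N.primeFactors _ hℓmem, hlamℓ', hlamℓ, hP, hPm, hχ]
    ring
  have hw' := rootNumber_eq_neg_frickeEigenvalue (W := W') (fun _ _ ↦ IsNewform0.exists_functional_equation_holds)
    (fun _ _ ↦ IsNewform0.frickeEigenvalue_eq_one_or_eq_neg_one_holds) hf'
  have hw := rootNumber_eq_neg_frickeEigenvalue (W := W) (fun _ _ ↦ IsNewform0.exists_functional_equation_holds)
    (fun _ _ ↦ IsNewform0.frickeEigenvalue_eq_one_or_eq_neg_one_holds) hf
  have h : ((W'.rootNumber : ℤ) : ℂ) = -((W.rootNumber : ℤ) : ℂ) := by rw [hw', hw, hεeq]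
  exact_mod_cast h

end Summit.BirchSwinnertonDyer.BirchSwinnertonDyer.Theorems.TwistRootNumberTwisted

end
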